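import Summits.ResolutionOfSingularities.ResolutionOfSingularities.Theorems.FrobeniusLadderFInjectiveMacaulayficationE4GermPointBlowupFull
import HarnessLib

/-!
# (O-3) THE LOOP GERM `L = e² + a²ce + ac² + acd² + ab³c²` AND ITS SINGULAR-PLANE BLOW-UP: strict transforms, primality, and the CURE AT CHART LEVEL
# (crux `FInjectiveMacaulayfication` stmt-ResolutionOfSingularities-15315, chain w45a; res-L1-w45a-plan-1 g19 RULING R19.18 «(O-3) the loop germ is cured in one
# singular-plane step»; seat res-L1-w45a-stub-3 g10)

[OURS · L1 W4.5a] Support file (`--supports stmt-ResolutionOfSingularities-15315 --as helper`); unconditional; replaces the role of NO printed item; NOT a statement of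
the manuscript; AI-written (AI review is weaker than expert review). Def-free (the term lists / cells of §3 are inlined literals).

SETTING. `L = X4² + X0²X2X4 + X0X2² + X0X2X3² + X0X1³X2²` (`a,b,c,d,e = X0..X4`) is res-L1-w45a-idea-1's germ `K₁` (FB5-r7) at which the rad-τ tower of d4lx6q7 LOOPS
(`L ⇄ M`, R19.16). The desk's reading of the mechanism: `Sing_red(L) ⊇ V(c,d,e) ∪ V(a,c,e)` (two planes meeting in the line `V(a,c,d,e) = rad τ(L)`); the Frobenius
recipe blows up the LINE and recreates the core; blowing up one whole SINGULAR PLANE `V(c,d,e)` cures. This file is the chart-level kernel content of the cure: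
* §1 ★ `prime_L` (any field: `T² + C(a²c)T + C(ac² + acd² + ab³c²)`, Eisenstein-type at `(a,b,c,d) = (1,0,0,1)`, `∂_c = ad² = 1`); `L_mem_sq_cde : L ∈ (c,d,e)²`,
  `L_mem_sq_ace : L ∈ (a,c,e)²` (termwise);
* §2 ★ `theta_c/d/e` — the strict transforms under the blow-up of the plane `V(c,d,e)` (`θ_c : d ↦ dc, e ↦ ec`; `θ_d : c ↦ cd, e ↦ ed`; `θ_e : c ↦ ce, d ↦ de`; `a, b`
  fixed): `L∘θ_c = c²·L_c`, `L_c = e² + a²e + a + acd² + ab³`; `L∘θ_d = d²·L_d`, `L_d = e² + a²ce + ac² + acd + ab³c²`; `L∘θ_e = e²·L_e`,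
  `L_e = 1 + a²c + ac² + acd²e + ab³c²`; `prime_L_c`, `prime_L_d` (Eisenstein-type, any field);
* §3 ★★ THE CURE AT CHART LEVEL (`char k = 2`): each `k[X]/(L_i)` satisfies the Cohen–Macaulay + Frobenius-closed clause at EVERY maximal ideal — ONE THIN FEDDER CELL each
  (square-free p-basis classes with unit coefficient: `a` in `L_c`, `acd` in `L_d`, the constant `1` in `L_e`; so `L_i ∉ 𝔫^{[2]}` at every maximal `𝔫`), by
  res-L1-w45a-stub-2's `E4GermPointBlowupFull.clause_of_thinCell` (`checkKs` by `decide +kernel`): `clause_chart_c`, `clause_chart_d`, `clause_chart_e`.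
The identification of `k[X]/(L_i)` with the Rees charts of `Bl_{(c,d,e)} Spec k[X]/(L)` and the scheme-level cure are the sequel file.
[folklore mathematics, OURS as a certificate; cite: Fedder1983, Prop. 1.7 and Thm. 1.12; Kollar2007, §2.5 (strict transforms); StacksProject, Tag 0804]
-/

-- single-problem summit: the doubled namespace component is forced
set_option linter.dupNamespace false

noncomputable section

open AlgebraicGeometry CategoryTheory Literature.AlgebraicGeometry.Resolution TopologicalSpace IsLocalRing MvPolynomial

namespace Summit.ResolutionOfSingularities.ResolutionOfSingularities.Theorems.FInjectiveMacaulayfication.LoopGermLCharts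

open Summit.ResolutionOfSingularities.ResolutionOfSingularities.Theorems.FInjectiveMacaulayfication
open SliceableCentre

variable (k : Type) [Field k]

/-! ## §1 The germ `L`: primality, `L ∈ (c,d,e)²`, `L ∈ (a,c,e)²` -/

/-- Eisenstein-type primality of a quadric `T² + C b·T + C c` over `k[X0..X3]` presented through `X4 ↦ T`: if `b(α) = c(α) = 0` and `∂_j c (α) ≠ 0` at some point `α`,
then `f` is prime (shared by `L`, `L_c`, `L_d`). [folklore; `irreducible_X_pow_add_C_mul_X_add_C`] -/
theorem prime_of_quadric (f : MvPolynomial (Fin 5) k) (b c : MvPolynomial (Fin 4) k)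
    (hf : f = X 4 ^ 2 + rename Fin.castSucc b * X 4 + rename Fin.castSucc c) (α : Fin 4 → k) (hbα : MvPolynomial.eval α b = 0) (hcα : MvPolynomial.eval α c = 0)
    (j : Fin 4) (hder : MvPolynomial.eval α (pderiv j c) ≠ 0) : Prime f := by
  set e : MvPolynomial (Fin 5) k ≃+* Polynomial (MvPolynomial (Fin 4) k) :=
    ((renameEquiv k (_root_.finRotate 5)).trans (finSuccEquiv k 4)).toRingEquiv with he_def
  have hrot4 : (_root_.finRotate 5) (4 : Fin 5) = 0 := by decide
  have hrot : ∀ i : Fin 4, (_root_.finRotate 5) (Fin.castSucc i) = i.succ := by decide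
  have he4 : e (X 4) = Polynomial.X := by
    show finSuccEquiv k 4 (rename _ (X 4)) = _
    rw [rename_X, hrot4]; exact finSuccEquiv_X_zero
  have hej : ∀ i : Fin 4, e (X (Fin.castSucc i)) = Polynomial.C (X i) := fun i => by
    show finSuccEquiv k 4 (rename _ (X (Fin.castSucc i))) = _
    rw [rename_X, hrot i]; exact finSuccEquiv_X_succ (j := i)
  have hren : ∀ q : MvPolynomial (Fin 4) k, e (rename Fin.castSucc q) = Polynomial.C q := by
    intro q
    induction q using MvPolynomial.induction_on with
    | C a =>
      rw [rename_C]
      show finSuccEquiv k 4 (rename _ (C a)) = _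
      rw [rename_C, finSuccEquiv_apply, eval₂Hom_C]; rfl
    | add p q hp hq => rw [map_add, map_add, hp, hq, Polynomial.C_add]
    | mul_X p i hp => rw [map_mul, map_mul, hp, rename_X, hej, Polynomial.C_mul]
  have hef : e f = Polynomial.X ^ 2 + Polynomial.C b * Polynomial.X + Polynomial.C c := by
    rw [hf, map_add, map_add, map_pow, map_mul, he4, hren, hren]
  have hirr : Irreducible (e f) := by
    rw [hef]
    exact Literature.AlgebraicGeometry.Motives.SmoothHypersurface.irreducible_X_pow_add_C_mul_X_add_C (d := 2) le_rfl b c α hbα hcα j hder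
  exact (MulEquiv.prime_iff e).mp hirr.prime

/-- ★ **`L` is PRIME** over any field: `T² + C(a²c)·T + C(ac² + acd² + ab³c²)`, at `(a,b,c,d) = (1,0,0,1)`: `a²c = 0`, the constant coefficient vanishes, and
`∂_c(ac² + acd² + ab³c²) = 2ac + ad² + 2ab³c = 1`. [folklore] -/
theorem prime_L (f : MvPolynomial (Fin 5) k) (hf : f = X 4 ^ 2 + X 0 ^ 2 * X 2 * X 4 + X 0 * X 2 ^ 2 + X 0 * X 2 * X 3 ^ 2 + X 0 * X 1 ^ 3 * X 2 ^ 2) : Prime f := by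
  refine prime_of_quadric k f (X 0 ^ 2 * X 2) (X 0 * X 2 ^ 2 + X 0 * X 2 * X 3 ^ 2 + X 0 * X 1 ^ 3 * X 2 ^ 2) ?_ ![1, 0, 0, 1] ?_ ?_ 2 ?_
  · rw [hf]; simp only [map_add, map_mul, map_pow, rename_X, Fin.castSucc_zero]; simp; ring
  · simp
  · simp
  · have e1 : pderiv 2 (X 0 * X 2 ^ 2 + X 0 * X 2 * X 3 ^ 2 + X 0 * X 1 ^ 3 * X 2 ^ 2 : MvPolynomial (Fin 4) k) =
        2 * (X 0 * X 2) + X 0 * X 3 ^ 2 + 2 * (X 0 * X 1 ^ 3 * X 2) := by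
      simp only [map_add, Derivation.leibniz, Derivation.leibniz_pow, pderiv_X_self, smul_eq_mul, pderiv_X_of_ne (show (0 : Fin 4) ≠ 2 by decide),
        pderiv_X_of_ne (show (1 : Fin 4) ≠ 2 by decide), pderiv_X_of_ne (show (3 : Fin 4) ≠ 2 by decide)]
      push_cast; ring
    rw [e1]; simp

/-- `L ∈ (c, d, e)²` (every term is divisible by two of `c, d, e`, or by `c²`, `e²`). [certificate] -/
theorem L_mem_sq_cde (f : MvPolynomial (Fin 5) k) (hf : f = X 4 ^ 2 + X 0 ^ 2 * X 2 * X 4 + X 0 * X 2 ^ 2 + X 0 * X 2 * X 3 ^ 2 + X 0 * X 1 ^ 3 * X 2 ^ 2) :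
    f ∈ (Ideal.span ({X 2, X 3, X 4} : Set (MvPolynomial (Fin 5) k))) ^ 2 := by
  have hc : (X 2 : MvPolynomial (Fin 5) k) ∈ Ideal.span ({X 2, X 3, X 4} : Set (MvPolynomial (Fin 5) k)) := Ideal.subset_span (by simp)
  have hd : (X 3 : MvPolynomial (Fin 5) k) ∈ Ideal.span ({X 2, X 3, X 4} : Set (MvPolynomial (Fin 5) k)) := Ideal.subset_span (by simp)
  have he : (X 4 : MvPolynomial (Fin 5) k) ∈ Ideal.span ({X 2, X 3, X 4} : Set (MvPolynomial (Fin 5) k)) := Ideal.subset_span (by simp)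
  have h2 : ∀ (p q : MvPolynomial (Fin 5) k), p ∈ Ideal.span ({X 2, X 3, X 4} : Set (MvPolynomial (Fin 5) k)) →
      q ∈ Ideal.span ({X 2, X 3, X 4} : Set (MvPolynomial (Fin 5) k)) → p * q ∈ (Ideal.span ({X 2, X 3, X 4} : Set (MvPolynomial (Fin 5) k))) ^ 2 :=
    fun p q hp hq => by rw [pow_two]; exact Ideal.mul_mem_mul hp hq
  rw [hf, show (X 4 ^ 2 + X 0 ^ 2 * X 2 * X 4 + X 0 * X 2 ^ 2 + X 0 * X 2 * X 3 ^ 2 + X 0 * X 1 ^ 3 * X 2 ^ 2 : MvPolynomial (Fin 5) k) = X 4 * X 4 + X 0 ^ 2 * (X 2 * X 4) + X 0 * (X 2 * X 2) + X 0 * X 3 * (X 2 * X 3) + X 0 * X 1 ^ 3 * (X 2 * X 2) by ring]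
  refine Ideal.add_mem _ (Ideal.add_mem _ (Ideal.add_mem _ (Ideal.add_mem _ (h2 _ _ he he) ?_) ?_) ?_) ?_
  · exact Ideal.mul_mem_left _ _ (h2 _ _ hc he)
  · exact Ideal.mul_mem_left _ _ (h2 _ _ hc hc)
  · exact Ideal.mul_mem_left _ _ (h2 _ _ hc hd)
  · exact Ideal.mul_mem_left _ _ (h2 _ _ hc hc)

/-- `L ∈ (a, c, e)²`. [certificate] -/
theorem L_mem_sq_ace (f : MvPolynomial (Fin 5) k) (hf : f = X 4 ^ 2 + X 0 ^ 2 * X 2 * X 4 + X 0 * X 2 ^ 2 + X 0 * X 2 * X 3 ^ 2 + X 0 * X 1 ^ 3 * X 2 ^ 2) :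
    f ∈ (Ideal.span ({X 0, X 2, X 4} : Set (MvPolynomial (Fin 5) k))) ^ 2 := by
  have ha : (X 0 : MvPolynomial (Fin 5) k) ∈ Ideal.span ({X 0, X 2, X 4} : Set (MvPolynomial (Fin 5) k)) := Ideal.subset_span (by simp)
  have hc : (X 2 : MvPolynomial (Fin 5) k) ∈ Ideal.span ({X 0, X 2, X 4} : Set (MvPolynomial (Fin 5) k)) := Ideal.subset_span (by simp)
  have he : (X 4 : MvPolynomial (Fin 5) k) ∈ Ideal.span ({X 0, X 2, X 4} : Set (MvPolynomial (Fin 5) k)) := Ideal.subset_span (by simp)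
  have h2 : ∀ (p q : MvPolynomial (Fin 5) k), p ∈ Ideal.span ({X 0, X 2, X 4} : Set (MvPolynomial (Fin 5) k)) →
      q ∈ Ideal.span ({X 0, X 2, X 4} : Set (MvPolynomial (Fin 5) k)) → p * q ∈ (Ideal.span ({X 0, X 2, X 4} : Set (MvPolynomial (Fin 5) k))) ^ 2 :=
    fun p q hp hq => by rw [pow_two]; exact Ideal.mul_mem_mul hp hq
  rw [hf, show (X 4 ^ 2 + X 0 ^ 2 * X 2 * X 4 + X 0 * X 2 ^ 2 + X 0 * X 2 * X 3 ^ 2 + X 0 * X 1 ^ 3 * X 2 ^ 2 : MvPolynomial (Fin 5) k) = X 4 * X 4 + X 0 * X 4 * (X 0 * X 2) + X 2 * (X 0 * X 2) + X 3 ^ 2 * (X 0 * X 2) + X 1 ^ 3 * X 2 * (X 0 * X 2) by ring]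
  refine Ideal.add_mem _ (Ideal.add_mem _ (Ideal.add_mem _ (Ideal.add_mem _ (h2 _ _ he he) ?_) ?_) ?_) ?_
  all_goals exact Ideal.mul_mem_left _ _ (h2 _ _ ha hc)

/-! ## §2 The strict transforms under the blow-up of the plane `V(c,d,e)` -/

/-- ★ **Chart `D(c)`**: `θ_c : d ↦ dc, e ↦ ec` gives `L∘θ_c = c²·L_c`, `L_c = e² + a²e + a + acd² + ab³`. [folklore] -/
theorem theta_c (f : MvPolynomial (Fin 5) k) (hf : f = X 4 ^ 2 + X 0 ^ 2 * X 2 * X 4 + X 0 * X 2 ^ 2 + X 0 * X 2 * X 3 ^ 2 + X 0 * X 1 ^ 3 * X 2 ^ 2) :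
    aeval ![(X 0 : MvPolynomial (Fin 5) k), X 1, X 2, X 3 * X 2, X 4 * X 2] f = X 2 ^ 2 * (X 4 ^ 2 + X 0 ^ 2 * X 4 + X 0 + X 0 * X 2 * X 3 ^ 2 + X 0 * X 1 ^ 3) := by
  subst hf; simp; ring

/-- ★ **Chart `D(d)`**: `θ_d : c ↦ cd, e ↦ ed` gives `L∘θ_d = d²·L_d`, `L_d = e² + a²ce + ac² + acd + ab³c²`. [folklore] -/
theorem theta_d (f : MvPolynomial (Fin 5) k) (hf : f = X 4 ^ 2 + X 0 ^ 2 * X 2 * X 4 + X 0 * X 2 ^ 2 + X 0 * X 2 * X 3 ^ 2 + X 0 * X 1 ^ 3 * X 2 ^ 2) :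
    aeval ![(X 0 : MvPolynomial (Fin 5) k), X 1, X 2 * X 3, X 3, X 4 * X 3] f = X 3 ^ 2 * (X 4 ^ 2 + X 0 ^ 2 * X 2 * X 4 + X 0 * X 2 ^ 2 + X 0 * X 2 * X 3 + X 0 * X 1 ^ 3 * X 2 ^ 2) := by
  subst hf; simp; ring

/-- ★ **Chart `D(e)`**: `θ_e : c ↦ ce, d ↦ de` gives `L∘θ_e = e²·L_e`, `L_e = 1 + a²c + ac² + acd²e + ab³c²`. [folklore] -/
theorem theta_e (f : MvPolynomial (Fin 5) k) (hf : f = X 4 ^ 2 + X 0 ^ 2 * X 2 * X 4 + X 0 * X 2 ^ 2 + X 0 * X 2 * X 3 ^ 2 + X 0 * X 1 ^ 3 * X 2 ^ 2) :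
    aeval ![(X 0 : MvPolynomial (Fin 5) k), X 1, X 2 * X 4, X 3 * X 4, X 4] f = X 4 ^ 2 * (1 + X 0 ^ 2 * X 2 + X 0 * X 2 ^ 2 + X 0 * X 2 * X 3 ^ 2 * X 4 + X 0 * X 1 ^ 3 * X 2 ^ 2) := by
  subst hf; simp; ring

/-- `L_c` is prime (any field): `T² + C(a²)T + C(a(1 + cd² + b³))`, at the origin the constant coefficient vanishes with `∂_a = 1`. [folklore] -/
theorem prime_L_c (g : MvPolynomial (Fin 5) k) (hg : g = X 4 ^ 2 + X 0 ^ 2 * X 4 + X 0 + X 0 * X 2 * X 3 ^ 2 + X 0 * X 1 ^ 3) : Prime g := by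
  refine prime_of_quadric k g (X 0 ^ 2) (X 0 + X 0 * X 2 * X 3 ^ 2 + X 0 * X 1 ^ 3) ?_ ![0, 0, 0, 0] ?_ ?_ 0 ?_
  · rw [hg]; simp only [map_add, map_mul, map_pow, rename_X, Fin.castSucc_zero]; simp; ring
  · simp
  · simp
  · have e1 : pderiv 0 (X 0 + X 0 * X 2 * X 3 ^ 2 + X 0 * X 1 ^ 3 : MvPolynomial (Fin 4) k) = 1 + X 2 * X 3 ^ 2 + X 1 ^ 3 := by
      simp only [map_add, Derivation.leibniz, Derivation.leibniz_pow, pderiv_X_self, smul_eq_mul, pderiv_X_of_ne (show (1 : Fin 4) ≠ 0 by decide),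
        pderiv_X_of_ne (show (2 : Fin 4) ≠ 0 by decide), pderiv_X_of_ne (show (3 : Fin 4) ≠ 0 by decide)]
      push_cast; ring
    rw [e1]; simp

/-- `L_d` is prime (any field): `T² + C(a²c)T + C(ac² + acd + ab³c²)`, at `(1,0,0,1)`: `∂_c = 2ac + ad + 2ab³c = 1`. [folklore] -/
theorem prime_L_d (g : MvPolynomial (Fin 5) k) (hg : g = X 4 ^ 2 + X 0 ^ 2 * X 2 * X 4 + X 0 * X 2 ^ 2 + X 0 * X 2 * X 3 + X 0 * X 1 ^ 3 * X 2 ^ 2) : Prime g := by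
  refine prime_of_quadric k g (X 0 ^ 2 * X 2) (X 0 * X 2 ^ 2 + X 0 * X 2 * X 3 + X 0 * X 1 ^ 3 * X 2 ^ 2) ?_ ![1, 0, 0, 1] ?_ ?_ 2 ?_
  · rw [hg]; simp only [map_add, map_mul, map_pow, rename_X, Fin.castSucc_zero]; simp; ring
  · simp
  · simp
  · have e1 : pderiv 2 (X 0 * X 2 ^ 2 + X 0 * X 2 * X 3 + X 0 * X 1 ^ 3 * X 2 ^ 2 : MvPolynomial (Fin 4) k) =
        2 * (X 0 * X 2) + X 0 * X 3 + 2 * (X 0 * X 1 ^ 3 * X 2) := by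
      simp only [map_add, Derivation.leibniz, Derivation.leibniz_pow, pderiv_X_self, smul_eq_mul, pderiv_X_of_ne (show (0 : Fin 4) ≠ 2 by decide),
        pderiv_X_of_ne (show (1 : Fin 4) ≠ 2 by decide), pderiv_X_of_ne (show (3 : Fin 4) ≠ 2 by decide)]
      push_cast; ring
    rw [e1]; simp

/-! ## §3 ★★ The cure at chart level: thin Fedder cells for `L_c`, `L_d`, `L_e` (def-free: data inlined) -/

/-- ★★ **CURE, chart `D(c)`**: `k[X]/(L_c)` satisfies the CM + Frobenius-closed clause at EVERY maximal ideal (`char k = 2`) — one thin Fedder cell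
(the square-free class `a` with unit coefficient; term list and cell inlined, certificate by `decide +kernel`). [cite: Fedder1983, Thm. 1.12] -/
theorem clause_chart_c [CharP k 2] (g : MvPolynomial (Fin 5) k) (hg : g = X 4 ^ 2 + X 0 ^ 2 * X 4 + X 0 + X 0 * X 2 * X 3 ^ 2 + X 0 * X 1 ^ 3)
    (Q : Ideal (MvPolynomial (Fin 5) k ⧸ Ideal.span {g})) [Q.IsMaximal] :
    ∀ d : ℕ, ringKrullDim (Localization.AtPrime Q) = d → ∀ s : Fin d → Localization.AtPrime Q,
      (Ideal.span (Set.range s)).radical.IsMaximal →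
        RingTheory.Sequence.IsWeaklyRegular (Localization.AtPrime Q) (List.ofFn s) ∧
        ∀ y : Localization.AtPrime Q, (∃ e : ℕ, y ^ 2 ^ e ∈ Ideal.span
          ((fun z : Localization.AtPrime Q => z ^ 2 ^ e) '' (Ideal.span (Set.range s) : Set (Localization.AtPrime Q)))) → y ∈ Ideal.span (Set.range s) :=
  E4GermPointBlowupFull.clause_of_thinCell k
    [((1 : ℤ), ![0, 0, 0, 0, 2]), ((1 : ℤ), ![2, 0, 0, 0, 1]), ((1 : ℤ), ![1, 0, 0, 0, 0]), ((1 : ℤ), ![1, 0, 1, 2, 0]), ((1 : ℤ), ![1, 3, 0, 0, 0])]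
    [((∅ : Finset (Fin 5)), [(![1, 0, 0, 0, 0], [((1 : ℤ), ![0, 0, 0, 0, 0])])], (fun _ => []), [])]
    (by decide +kernel) (by simp) (by decide +kernel) g
    (hg.trans (by simp only [KLocCellKit.evalL, List.map_cons, List.map_nil, List.sum_cons, List.sum_nil, Int.cast_one, PConeFedderData.monomial_five]; ring)) Q

/-- ★★ **CURE, chart `D(d)`**: `k[X]/(L_d)` satisfies the CM + Frobenius-closed clause at EVERY maximal ideal (`char k = 2`) — one thin Fedder cell
(the square-free class `acd` with unit coefficient; term list and cell inlined, certificate by `decide +kernel`). [cite: Fedder1983, Thm. 1.12] -/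
theorem clause_chart_d [CharP k 2] (g : MvPolynomial (Fin 5) k) (hg : g = X 4 ^ 2 + X 0 ^ 2 * X 2 * X 4 + X 0 * X 2 ^ 2 + X 0 * X 2 * X 3 + X 0 * X 1 ^ 3 * X 2 ^ 2)
    (Q : Ideal (MvPolynomial (Fin 5) k ⧸ Ideal.span {g})) [Q.IsMaximal] :
    ∀ d : ℕ, ringKrullDim (Localization.AtPrime Q) = d → ∀ s : Fin d → Localization.AtPrime Q,
      (Ideal.span (Set.range s)).radical.IsMaximal →
        RingTheory.Sequence.IsWeaklyRegular (Localization.AtPrime Q) (List.ofFn s) ∧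
        ∀ y : Localization.AtPrime Q, (∃ e : ℕ, y ^ 2 ^ e ∈ Ideal.span
          ((fun z : Localization.AtPrime Q => z ^ 2 ^ e) '' (Ideal.span (Set.range s) : Set (Localization.AtPrime Q)))) → y ∈ Ideal.span (Set.range s) :=
  E4GermPointBlowupFull.clause_of_thinCell k
    [((1 : ℤ), ![0, 0, 0, 0, 2]), ((1 : ℤ), ![2, 0, 1, 0, 1]), ((1 : ℤ), ![1, 0, 2, 0, 0]), ((1 : ℤ), ![1, 0, 1, 1, 0]), ((1 : ℤ), ![1, 3, 2, 0, 0])]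
    [((∅ : Finset (Fin 5)), [(![1, 0, 1, 1, 0], [((1 : ℤ), ![0, 0, 0, 0, 0])])], (fun _ => []), [])]
    (by decide +kernel) (by simp) (by decide +kernel) g
    (hg.trans (by simp only [KLocCellKit.evalL, List.map_cons, List.map_nil, List.sum_cons, List.sum_nil, Int.cast_one, PConeFedderData.monomial_five]; ring)) Q

/-- ★★ **CURE, chart `D(e)`**: `k[X]/(L_e)` satisfies the CM + Frobenius-closed clause at EVERY maximal ideal (`char k = 2`) — one thin Fedder cell
(the square-free class `1` (the constant) with unit coefficient; term list and cell inlined, certificate by `decide +kernel`). [cite: Fedder1983, Thm. 1.12] -/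
theorem clause_chart_e [CharP k 2] (g : MvPolynomial (Fin 5) k) (hg : g = 1 + X 0 ^ 2 * X 2 + X 0 * X 2 ^ 2 + X 0 * X 2 * X 3 ^ 2 * X 4 + X 0 * X 1 ^ 3 * X 2 ^ 2)
    (Q : Ideal (MvPolynomial (Fin 5) k ⧸ Ideal.span {g})) [Q.IsMaximal] :
    ∀ d : ℕ, ringKrullDim (Localization.AtPrime Q) = d → ∀ s : Fin d → Localization.AtPrime Q,
      (Ideal.span (Set.range s)).radical.IsMaximal →
        RingTheory.Sequence.IsWeaklyRegular (Localization.AtPrime Q) (List.ofFn s) ∧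
        ∀ y : Localization.AtPrime Q, (∃ e : ℕ, y ^ 2 ^ e ∈ Ideal.span
          ((fun z : Localization.AtPrime Q => z ^ 2 ^ e) '' (Ideal.span (Set.range s) : Set (Localization.AtPrime Q)))) → y ∈ Ideal.span (Set.range s) :=
  E4GermPointBlowupFull.clause_of_thinCell k
    [((1 : ℤ), ![0, 0, 0, 0, 0]), ((1 : ℤ), ![2, 0, 1, 0, 0]), ((1 : ℤ), ![1, 0, 2, 0, 0]), ((1 : ℤ), ![1, 0, 1, 2, 1]), ((1 : ℤ), ![1, 3, 2, 0, 0])]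
    [((∅ : Finset (Fin 5)), [(![0, 0, 0, 0, 0], [((1 : ℤ), ![0, 0, 0, 0, 0])])], (fun _ => []), [])]
    (by decide +kernel) (by simp) (by decide +kernel) g
    (hg.trans (by simp only [KLocCellKit.evalL, List.map_cons, List.map_nil, List.sum_cons, List.sum_nil, Int.cast_one, PConeFedderData.monomial_five]; ring)) Q

end Summit.ResolutionOfSingularities.ResolutionOfSingularities.Theorems.FInjectiveMacaulayfication.LoopGermLCharts

end
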